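import Summits.CriticalPhenomena.PercolationContinuityZ3.Theorems.PercNearOneGluingNoHeavyLowerTailCILUnionExchange
import HarnessLib

/-!
# `NoHeavyLowerTail` (stmt-CriticalPhenomena-4575) — the CONDITIONAL selection lemma for TWO candidates and an
# ARBITRARY increasing cluster target (the pair case of the "level-`t` Lemma 2")

New-inequality factory #6 (prim-ineq-gen-6 gen 5), 2026-08-19, `--supports stmt-CriticalPhenomena-4575`.  No definitions,
no named facts, no sorries.  `μ = prodBernoulli w` on a finite vertex type, observer `o`, candidates `a₁ ≠ a₂`, an arbitrary
upper family `𝒜` of edge sets read on the open edge clusters (`A_i = {C_{a_i} ∈ 𝒜}`: `a_i ↔ b`, `|π(a_i)| > j`, …), labelled so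
that `a₁` is the LESS promising candidate, `t₁ = μ(A₁) ≤ t₂ = μ(A₂)`; `O_i = {o ↔ a_i}`, `G = O₂ ∖ O₁` ("`a₂` is `o`'s first
candidate" in the increasing-`t` order).  THEOREM (`conditionalSelection_pair`):

  **`(1 − t₂)·[μ(O₁ ∩ A₁) − μ(O₁)·t₁] + (1 − t₁)·[μ(G ∩ A₂) − μ(G)·t₂] ≥ 0`**,

i.e. (dividing by `(1 − t₁)(1 − t₂)`, `conditionalSelection_pair_csl`)

  **`μ(O₁ ∩ A₁ᶜ)/μ(A₁ᶜ) + μ(G ∩ A₂ᶜ)/μ(A₂ᶜ) ≤ μ(O₁ ∪ O₂)`** — "`Σ_c μ(W = c | C(c) ∉ 𝒜) ≤ μ(o ↔ {a₁,a₂})`",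

the two-candidate instance of the conditional selection principle CSP(1) of `…ConditionalSelection.lean` (whose
all-candidate form at the block target closes the crux, `noHeavyLowerTail_of_conditionalSelection`, and sits above
Kozma–Nitzan's Conjecture 1, `kozmaNitzan_conjecture1_of_conditionalSelection`).  It STRICTLY sharpens prim-hp-4's
`SelectionOrder.averagedPostFKG_pair_family` (`μ(O₁)t₁ + μ(G)t₂ ≤ μ((O₁ ∪ O₂) ∩ {C_o ∈ 𝒜})`: the same covariances weighted
`1 : 1` instead of `1/(1−t₁) : 1/(1−t₂)`).  For the block target at level `1` it is the two-block case of Kozma–Nitzan's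
Lemma 2.  PROOF ("Harris once, BHK twice", memo FINDING-G5.md §4): with `D = {a₁ ↮ a₂}` (so `G = D ∩ O₂`),
(1) Harris for `U = O₁ ∪ O₂ = O₁ ⊔ G` and `A₁`:  `μ(O₁A₁) + μ(GA₁) ≥ (μO₁ + μG)·t₁`;
(2) BHK Thm 1.4/1.5 given `D` (`C_{a₂}` versus `C_{a₁}`):  `μ(D)·μ(G ∩ A₁) ≤ μ(G)·μ(D ∩ A₁)`  — (1)+(2) are the
    hypothesis-free "lift transfer" `μ(D)·Cov(O₁, A₁) ≥ μ(G)·Cov(1_{Dᶜ}, A₁)`;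
(3) BHK Thm 1.3 given `D` (inside `C_{a₂}`):  `μ(D)·μ(G ∩ A₂) ≥ μ(G)·μ(D ∩ A₂)`;
(4) algebra: with `c = μ(A₁ ∩ Dᶜ) = μ(A₂ ∩ Dᶜ)` (on `{a₁ ↔ a₂}` the two clusters coincide), `t_i = c + μ(D ∩ A_i)`,
    `μ(D)·LHS = (1−t₂)μ(D)·[slack of (1)] + (1−t₂)·[slack of (2)] + (1−t₁)·[slack of (3)] + μ(G)(t₂−t₁)(μ(Dᶜ) − c) ≥ 0`.
Census (exact enumeration, all connected graphs on ≤ 6 vertices, all relay sets and levels, nine weightings; FINDING-G5.md):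
0 violations in 6.1·10⁷ ordered pairs; the hypothesis `t₁ ≤ t₂` is necessary (3–5 % violations in the wrong order).
-/

noncomputable section

open MeasureTheory Set
open Literature.Probability.LatticeModels (prodBernoulli)
open Literature.Probability.Percolation Literature.Probability.Percolation.KNPreFKG

namespace Summit.CriticalPhenomena.PercolationContinuityZ3.Theorems

namespace ConditionalSelection

variable {V : Type*}

/-- The algebraic core of the pair inequality: from the Harris slack `hH`, the two BHK slacks `hB15`, `hB13`, the
decompositions `t_i = c + dA_i`, `j + d = 1`, `c ≤ j`, and `dA₁ ≤ dA₂`, conclude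
`(1 − t₂)(m₁₁ − o₁ t₁) + (1 − t₁)(gA₂ − g t₂) ≥ 0`. [this work] -/
theorem pair_algebra {d j c dA₁ dA₂ o₁ g m₁₁ gA₁ gA₂ : ℝ}
    (hd : 0 < d) (hj : j + d = 1) (hc : c ≤ j) (hg : 0 ≤ g) (hΔ : dA₁ ≤ dA₂)
    (ht₂ : c + dA₂ ≤ 1)
    (hH : (o₁ + g) * (c + dA₁) ≤ m₁₁ + gA₁)
    (hB15 : d * gA₁ ≤ g * dA₁) (hB13 : g * dA₂ ≤ d * gA₂) :
    0 ≤ (1 - (c + dA₂)) * (m₁₁ - o₁ * (c + dA₁)) + (1 - (c + dA₁)) * (gA₂ - g * (c + dA₂)) := by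
  have ht₁ : c + dA₁ ≤ 1 := by linarith
  have key : d * ((1 - (c + dA₂)) * (m₁₁ - o₁ * (c + dA₁)) + (1 - (c + dA₁)) * (gA₂ - g * (c + dA₂))) =
      (1 - (c + dA₂)) * d * (m₁₁ + gA₁ - (o₁ + g) * (c + dA₁)) +
        (1 - (c + dA₂)) * (g * dA₁ - d * gA₁) + (1 - (c + dA₁)) * (d * gA₂ - g * dA₂) +
          g * (dA₂ - dA₁) * (j - c) +
            g * (dA₂ - dA₁) * (1 - (j + d)) := by
    ring
  rw [hj, sub_self, mul_zero, add_zero] at key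
  have h1 : 0 ≤ (1 - (c + dA₂)) * d * (m₁₁ + gA₁ - (o₁ + g) * (c + dA₁)) :=
    mul_nonneg (mul_nonneg (by linarith) hd.le) (by linarith)
  have h2 : 0 ≤ (1 - (c + dA₂)) * (g * dA₁ - d * gA₁) := mul_nonneg (by linarith) (by linarith)
  have h3 : 0 ≤ (1 - (c + dA₁)) * (d * gA₂ - g * dA₂) := mul_nonneg (by linarith) (by linarith)
  have h4 : 0 ≤ g * (dA₂ - dA₁) * (j - c) := mul_nonneg (mul_nonneg hg (by linarith)) (by linarith)
  have hprod : 0 ≤ d * ((1 - (c + dA₂)) * (m₁₁ - o₁ * (c + dA₁)) +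
      (1 - (c + dA₁)) * (gA₂ - g * (c + dA₂))) := by
    rw [key]; linarith
  exact nonneg_of_mul_nonneg_right (by simpa [mul_comm] using hprod) hd

variable [Fintype V]

open UnionExchange in
/-- **Conditional selection lemma for two candidates (any increasing cluster target), product form.**
For `a₁ ≠ a₂`, an upper family `𝒜`, `A_i = {C_{a_i} ∈ 𝒜}` with `μ(A₁) ≤ μ(A₂)`, `O_i = {o ↔ a_i}`, `G = O₂ ∩ O₁ᶜ`:
`0 ≤ (1 − μA₂)·(μ(O₁ ∩ A₁) − μO₁·μA₁) + (1 − μA₁)·(μ(G ∩ A₂) − μG·μA₂)`.  Harris once (for `O₁ ∪ O₂` and `A₁`) and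
van den Berg–Häggström–Kahn twice given `{a₁ ↮ a₂}`.
[cite: Harris1960] [cite: VandenbergHaggstromKahn2005, Thms. 1.3–1.5] [cite: KozmaNitzan2024, Lemma 2 (p. 6)] [this work] -/
theorem conditionalSelection_pair (w : Sym2 V → unitInterval) (o a₁ a₂ : V) (h12 : a₁ ≠ a₂)
    {𝒜 : Set (Set (Sym2 V))} (h𝒜 : IsUpperSet 𝒜)
    (hp : (prodBernoulli w).real {ω : BondConfig V | openEdgeCluster ω a₁ ∈ 𝒜} ≤
      (prodBernoulli w).real {ω : BondConfig V | openEdgeCluster ω a₂ ∈ 𝒜}) :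
    0 ≤ (1 - (prodBernoulli w).real {ω : BondConfig V | openEdgeCluster ω a₂ ∈ 𝒜}) *
          ((prodBernoulli w).real (openConn o a₁ ∩ {ω : BondConfig V | openEdgeCluster ω a₁ ∈ 𝒜}) -
            (prodBernoulli w).real (openConn o a₁) *
              (prodBernoulli w).real {ω : BondConfig V | openEdgeCluster ω a₁ ∈ 𝒜}) +
        (1 - (prodBernoulli w).real {ω : BondConfig V | openEdgeCluster ω a₁ ∈ 𝒜}) *
          ((prodBernoulli w).real ((openConn o a₂ ∩ (openConn o a₁)ᶜ) ∩
              {ω : BondConfig V | openEdgeCluster ω a₂ ∈ 𝒜}) -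
            (prodBernoulli w).real (openConn o a₂ ∩ (openConn o a₁)ᶜ) *
              (prodBernoulli w).real {ω : BondConfig V | openEdgeCluster ω a₂ ∈ 𝒜}) := by
  classical
  set μ := prodBernoulli w with hμ
  set O₁ : Set (BondConfig V) := openConn o a₁ with hO₁
  set O₂ : Set (BondConfig V) := openConn o a₂ with hO₂
  set A₁ : Set (BondConfig V) := {ω | openEdgeCluster ω a₁ ∈ 𝒜} with hA₁
  set A₂ : Set (BondConfig V) := {ω | openEdgeCluster ω a₂ ∈ 𝒜} with hA₂
  set D : Set (BondConfig V) := {ω | ¬ (openGraph ω).Reachable a₁ a₂} with hD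
  have hmeas : ∀ S : Set (BondConfig V), MeasurableSet S := fun _ => MeasurableSet.of_discrete
  have hsplit : ∀ A S : Set (BondConfig V), μ.real A = μ.real (A ∩ S) + μ.real (A ∩ Sᶜ) := by
    intro A S
    rw [← measureReal_inter_add_sdiff (s := A) (hmeas S), Set.sdiff_eq]
  -- `G = O₂ ∩ O₁ᶜ = D ∩ O₂`
  have hG : O₂ ∩ O₁ᶜ = D ∩ O₂ := by
    ext ω
    simp only [mem_inter_iff, mem_compl_iff, hO₁, hO₂, hD, openConn, mem_setOf_eq]
    constructor
    · rintro ⟨h2, hn1⟩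
      exact ⟨fun h => hn1 (h2.trans h.symm), h2⟩
    · rintro ⟨hn, h2⟩
      exact ⟨h2, fun h1 => hn (h1.symm.trans h2)⟩
  rw [hG]
  -- on `Dᶜ = {a₁ ↔ a₂}` the two targets coincide
  have hADc : A₁ ∩ Dᶜ = A₂ ∩ Dᶜ := by
    ext ω
    simp only [mem_inter_iff, mem_compl_iff, hA₁, hA₂, hD, mem_setOf_eq, not_not]
    constructor
    · rintro ⟨hA, h⟩
      exact ⟨by rw [openEdgeCluster_eq_of_reachable h]; exact hA, h⟩
    · rintro ⟨hA, h⟩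
      exact ⟨by rw [← openEdgeCluster_eq_of_reachable h]; exact hA, h⟩
  -- (1) Harris for `U = O₁ ∪ O₂` and `A₁`, with `U = O₁ ⊔ (D ∩ O₂)`
  have hU : IsUpperSet (O₁ ∪ O₂ : Set (BondConfig V)) :=
    (isUpperSet_openConn o a₁).union (isUpperSet_openConn o a₂)
  have hHarris := Literature.Probability.LatticeModels.prodBernoulli_harris w hU
    (isUpperSet_setOf_openEdgeCluster_mem a₁ h𝒜) (hmeas _) (hmeas _)
  have hUsplit : μ.real (O₁ ∪ O₂) = μ.real O₁ + μ.real (D ∩ O₂) := by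
    rw [hsplit (O₁ ∪ O₂) O₁, ← hG]
    congr 1
    · rw [union_inter_cancel_left]
    · congr 1
      ext ω
      simp only [mem_inter_iff, mem_union, mem_compl_iff]
      tauto
  have hUAsplit : μ.real ((O₁ ∪ O₂) ∩ A₁) = μ.real (O₁ ∩ A₁) + μ.real (D ∩ O₂ ∩ A₁) := by
    have ea : (O₁ ∪ O₂) ∩ A₁ ∩ O₁ = O₁ ∩ A₁ := by
      ext ω; simp only [mem_inter_iff, mem_union]; tauto
    have eb : (O₁ ∪ O₂) ∩ A₁ ∩ O₁ᶜ = D ∩ O₂ ∩ A₁ := by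
      rw [← hG]; ext ω; simp only [mem_inter_iff, mem_union, mem_compl_iff]; tauto
    rw [hsplit ((O₁ ∪ O₂) ∩ A₁) O₁, ea, eb]
  simp only [← hμ, ← hA₁] at hHarris
  rw [hUsplit, hUAsplit] at hHarris
  -- Harris for `O₁` and `A₁` (used when `D` is null)
  have hHO := Literature.Probability.LatticeModels.prodBernoulli_harris w (isUpperSet_openConn o a₁)
    (isUpperSet_setOf_openEdgeCluster_mem a₁ h𝒜) (hmeas _) (hmeas _)
  simp only [← hμ, ← hA₁, ← hO₁] at hHO
  -- (2),(3) BHK given `D`, in the cluster of `a₂` (versus the cluster of `a₁`)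
  have hD2 : {ω : BondConfig V | ∀ x ∈ ({a₁} : Set V), ¬ (openGraph ω).Reachable a₂ x} = D := by
    ext ω
    simp only [mem_setOf_eq, mem_singleton_iff, forall_eq, hD]
    exact not_congr ⟨SimpleGraph.Reachable.symm, SimpleGraph.Reachable.symm⟩
  have hD3 : {ω : BondConfig V | ¬ (openGraph ω).Reachable a₂ a₁} = D := by
    ext ω
    simp only [mem_setOf_eq, hD]
    exact not_congr ⟨SimpleGraph.Reachable.symm, SimpleGraph.Reachable.symm⟩
  -- (3) `μ(D ∩ O₂) μ(D ∩ A₂) ≤ μ(D) μ(D ∩ (O₂ ∩ A₂))` (Thm. 1.3 in `C_{a₂}`)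
  have h13 := bhk_one_upper_upper w a₂ ({a₁} : Set V) (by simpa using Ne.symm h12)
    (isUpperSet_connFamily a₂ o) h𝒜
  rw [hD2, ← openConn_eq_setOf_connFamily, openConn_symm a₂ o] at h13
  -- (2) `μ(D) μ(D ∩ (O₂ ∩ A₁)) ≤ μ(D ∩ O₂) μ(D ∩ A₁)` (Thm. 1.4/1.5, `C_{a₂}` versus `C_{a₁}`)
  have h15 := bhk_two_upper_upper w a₂ a₁ (Ne.symm h12) (isUpperSet_connFamily a₂ o) h𝒜
  rw [hD3, ← openConn_eq_setOf_connFamily, openConn_symm a₂ o] at h15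
  simp only [← hμ, ← hO₂, ← hA₁, ← hA₂] at h13 h15
  have e2 : D ∩ (O₂ ∩ A₂) = D ∩ O₂ ∩ A₂ := (inter_assoc _ _ _).symm
  have e1 : D ∩ (O₂ ∩ A₁) = D ∩ O₂ ∩ A₁ := (inter_assoc _ _ _).symm
  rw [e2] at h13
  rw [e1] at h15
  -- decompositions `t_i = c + μ(D ∩ A_i)` with the same `c`, `μ(Dᶜ) + μ(D) = 1`
  have htA1 : μ.real A₁ = μ.real (A₁ ∩ Dᶜ) + μ.real (D ∩ A₁) := by
    rw [hsplit A₁ Dᶜ, compl_compl, inter_comm A₁ D]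
  have htA2 : μ.real A₂ = μ.real (A₁ ∩ Dᶜ) + μ.real (D ∩ A₂) := by
    rw [hsplit A₂ Dᶜ, compl_compl, inter_comm A₂ D, hADc]
  have hjd : μ.real Dᶜ + μ.real D = 1 := by
    have := probReal_compl_eq_one_sub (μ := μ) (hmeas D)
    linarith
  have hcj : μ.real (A₁ ∩ Dᶜ) ≤ μ.real Dᶜ := measureReal_mono inter_subset_right
  have ht2le : μ.real (A₁ ∩ Dᶜ) + μ.real (D ∩ A₂) ≤ 1 := by rw [← htA2]; exact measureReal_le_one
  have hΔ : μ.real (D ∩ A₁) ≤ μ.real (D ∩ A₂) := by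
    have h' := hp; rw [htA1, htA2] at h'; linarith
  rw [htA1] at hHarris hHO
  rw [htA1, htA2]
  by_cases hD0 : μ.real D = 0
  · -- `D` null: every `D ∩ ·` is null and the claim is `(1 - t₂)·Cov(O₁, A₁) ≥ 0` (Harris)
    have hz : ∀ S : Set (BondConfig V), μ.real (D ∩ S) = 0 := fun S =>
      le_antisymm ((measureReal_mono inter_subset_left).trans hD0.le) measureReal_nonneg
    have hz2 : ∀ S S' : Set (BondConfig V), μ.real (D ∩ S ∩ S') = 0 := fun S S' =>
      le_antisymm ((measureReal_mono inter_subset_left).trans (hz S).le) measureReal_nonneg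
    rw [hz A₁, hz A₂] at *
    rw [hz O₂, hz2 O₂ A₂]
    nlinarith [hHO, ht2le, measureReal_nonneg (μ := μ) (s := O₁ ∩ A₁)]
  · have hDpos : 0 < μ.real D := lt_of_le_of_ne measureReal_nonneg (Ne.symm hD0)
    exact pair_algebra hDpos hjd hcj measureReal_nonneg hΔ ht2le hHarris h15 h13

end ConditionalSelection

end Summit.CriticalPhenomena.PercolationContinuityZ3.Theorems

end
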